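/-
Copyright (c) 2026. All rights reserved.
Released under Apache 2.0 license as described in the file LICENSE.
Authors: abc-iut cell, seat abc-iut-w5-d169 (gen 16; row «PL2-LEAF-2», leaf (T⇒E)).
-/
import Literature.AnabelianGeometry.EtaleTheta.ZHatLevelDetermination
import Literature.AnabelianGeometry.EtaleTheta.SettingModelFoxLevelTorus
import Literature.AnabelianGeometry.EtaleTheta.SettingModelFoxLevelBalanced
import Literature.AnabelianGeometry.AbsoluteAnabelian.ZHatCompletionAdicCompleteness
import Mathlib.FieldTheory.Finite.Basic
import Mathlib.Data.Fintype.Perm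
import HarnessLib

/-!
# (T⇒E): the torus law forces a-balance at every level

Lyndon–Schupp, *Combinatorial Group Theory*, Ch. II §3 (Fox calculus read in a finite quotient)
[cite: LyndonSchupp2001, Ch. II §3]; Mochizuki, *The étale theta function …* [EtTh] §1, PRIMS p. 12 («`Δ_X` … a
profinite free group on 2 generators») [cite: MochizukiEtTh2009, §1 p.12] — OUR model `F̂₂ = F₂hatT` with the
cyclotomic twists `twist φ` / `twistEnd u` and `Ẑ`-powers `powHat` (abc-iut-w5-d024), the level characters
`ZHatLevel.levelChar` / compatible families of `CyclotomeZHatAction` / `ZHatLevelDetermination`, the level Fox maps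
`FoxLevel.lev / fox / alpha` with their package (c1)–(c4) (abc-iut-f-069, `SettingModelFoxLevelMaps` / `…Torus`) and
the orbit-criterion file `SettingModelFoxLevelBalanced` (gen 16, `alpha_pow_orderOf_lev`), all consumed BY NAME.  The
action is an ARBITRARY `ρ : Γ → Aut(Ẑ)` satisfying (Hχ‴); for `ρ = χ` on `G_{ℚ_p}` (Hχ‴) is
`SettingModel.exists_levelChar_chi_pow_ne_one` (`SettingModelCyclotomicCharacterPrimaryUnbounded`, gen 16).

PROOF-ONLY file (no definition, no instance, no notation), abc-iut cell layer L6, seat abc-iut-w5-d169 (gen 16), row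
PL2-LEAF-2 of abc-iut-L6-lead — leaf **(T⇒E)** of programme P-L2, rung (L2-T): Lemma 4′ of the cell's desk text
PL2-SEP-PROOF-v2 (sha16 9791feedc2eba23e) §5 with the topology-free refinement (R1) of PL2-SEP-v2-NOTES
(a540c16b9a5d4139), quoted: *«CLAIM: under (Hχ′), a `w` satisfying the torus law is a-balanced at EVERY open
normal `N`. … `Φ_u(x) = u·ḡ_u·x` … `L_u := u_ℓ⁻¹Φ_u` … permutes `S` … pick `u ∈ U₂` with `u_ℓ ≠ 1` … so
`(u_ℓ − 1)(α_{w^m})_ℓ = 0` in `ℤ_ℓ[G]`, `(α_{w^m})_ℓ = 0`.»*  Here in FINITE coefficients, exactly the hypothesis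
shape of THEOREM A `SettingModel.exists_eq_conj_bPow_of_forall_level_balanced`:

* `powHat_pow` (`(x^n)^t = (x^t)^n`), `levelChar_pow_totient` (`χ_n(ψ)^{φ(n)} = 1`),
  `pow_factorial_smul_eq_self` (a unit `c` with `c • x` a left translate of `x : G → K` satisfies
  `c^{|G|!} • x = x`: `c` permutes the finite set of translates);
* ★ **`normL_lev_alpha_eq_zero_of_torusLaw`** — if `θ_{ρ(γ)}(w)` is conjugate to `w^{ρ(γ)(1)}` for every
  `γ ∈ Γ` ((Hχ‴) for `ρ`), then for every finite group `G`, all `A B : G` and every prime `ℓ` the level Fox chain of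
  `w` at `(G, ZMod ℓ, A, B)` has `N_{π w} · α_w = 0`.  Proof: `n = ord B`, `o = ord(π w)`, `x = α_{w^o} = N_{π w}·α_w`
  with coefficients `ℤ/ℓ^k`; by (Hχ‴) choose `γ₀`, `k` with `χ_{ℓ^k}(ρ(γ₀)^{φ(n)·|G|!}) ≠ 1`; for `φ = ρ(γ₀)^{φ(n)}`
  (`u = φ(1) ≡ 1 (mod n)`) the torus law at `w^o` gives `x = π(g)·(c • x)`, `c = χ_{ℓ^k}(φ)` ((c4) leaves `α`
  unchanged; (c1), (c3) evaluate the conjugate of `(w^o)^u`); hence `c^{|G|!} • x = x` with `c^{|G|!} ≠ 1` in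
  `ℤ/ℓ^k`, so `x ≡ 0 (mod ℓ)` (`alpha_eq_comp`).
Classical finite group / `ℓ`-adic bookkeeping about OUR semi-synthetic model; nothing of [EtTh] is asserted; no side
is taken on [IUTchIII] Cor. 3.12; typed ≠ proved ≠ print.
-/

noncomputable section

open CategoryTheory ProfiniteGrp ProfiniteGrp.ProfiniteCompletion

namespace Literature.AnabelianGeometry.EtaleTheta.SettingModel

open ZHatLevel FoxLevel
open Literature.GroupTheory.CombinatorialGroupTheory.FoxChain
open Literature.AnabelianGeometry.AbsoluteAnabelian.AbsTopII

/-! ### Preliminaries on `Ẑ`-powers and cyclotomic characters -/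

/-- `Ẑ`-powers of a power: `(x^n)^t = (x^t)^n` (both are continuous one-parameter groups through `x^n`;
`powHat_unique`). [cite: MochizukiEtTh2009, §1 p.12] -/
theorem powHat_pow (x : F₂hatT) (n : ℕ) (t : ZH) : powHat (x ^ n) t = powHat x t ^ n := by
  have hc : ∀ s t : ZH, Commute (powHat x s) (powHat x t) := fun s t => by
    change powHat x s * powHat x t = powHat x t * powHat x s
    rw [← map_mul, ← map_mul, Literature.AnabelianGeometry.AbsoluteAnabelian.ZHatCompletion.mul_comm]
  let f : ZH →ₜ* F₂hatT :=
    ⟨{ toFun := fun t => powHat x t ^ n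
       map_one' := by rw [map_one, one_pow]
       map_mul' := fun s t => by rw [map_mul, (hc s t).mul_pow] }, (powHat x).continuous.pow n⟩
  have hf : f = powHat (x ^ n) := powHat_unique _ f (by
    change powHat x (iotaZ (Multiplicative.ofAdd 1)) ^ n = x ^ n
    rw [powHat_iotaZ_one])
  exact (DFunLike.congr_fun hf t).symm

/-- The level cyclotomic characters are units: `χ_n(ψ)^{φ(n)} = 1` (Euler). [cite: RibesZalesskii2010, Thm 2.7.1] -/
theorem levelChar_pow_totient (n : ℕ+) (ψ : MulAut ZH) : levelChar n ψ ^ Nat.totient n = 1 := by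
  haveI : NeZero (n : ℕ) := ⟨n.ne_zero⟩
  obtain ⟨v, hv⟩ := isUnit_iff_exists_inv.2 ⟨_, levelChar_mul_levelChar_inv n ψ⟩
  rw [← hv, ← Units.val_pow_eq_pow_val, ZMod.pow_totient, Units.val_one]

/-- In `ℤ/ℓ^k`: if `d ≠ 0` and `d·z = 0` then `z ≡ 0 (mod ℓ)` (`v_ℓ(d) < k` forces `v_ℓ(z) ≥ 1`). [folklore] -/
private theorem cast_eq_zero_of_mul_eq_zero {ℓ k : ℕ} (hℓ : ℓ.Prime) (hk : k ≠ 0) [NeZero (ℓ ^ k)]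
    {d z : ZMod (ℓ ^ k)} (hd : d ≠ 0) (h : d * z = 0) :
    ZMod.castHom (dvd_pow_self ℓ hk) (ZMod ℓ) z = 0 := by
  rw [ZMod.castHom_apply, ZMod.cast_eq_val, ZMod.natCast_eq_zero_iff]
  by_contra hz
  have hdz : ℓ ^ k ∣ d.val * z.val := by
    rw [← ZMod.natCast_eq_zero_iff, Nat.cast_mul, ZMod.natCast_zmod_val, ZMod.natCast_zmod_val, h]
  have hcop : Nat.Coprime (ℓ ^ k) z.val := ((hℓ.coprime_iff_not_dvd).2 hz).pow_left k
  have hdvd : ℓ ^ k ∣ d.val := hcop.dvd_of_dvd_mul_right hdz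
  exact hd ((ZMod.val_eq_zero d).1 (Nat.eq_zero_of_dvd_of_lt hdvd (ZMod.val_lt d)))

/-! ### The orbit / permutation step -/

/-- **Scalar stabiliser of a translation orbit has bounded exponent.**  Let `x : G → K` and `c ∈ K` a UNIT with
`c • x` a LEFT TRANSLATE of `x`.  Then `c` permutes the finite set `G·x` of translates, so `c^{|G|!} • x = x`.
[cite: LyndonSchupp2001, Ch. II §3] -/
theorem pow_factorial_smul_eq_self {G : Type} [Group G] [Fintype G] [DecidableEq G] {K : Type} [CommRing K]
    [DecidableEq K] {c : K} (hc : IsUnit c) {x : G → K} {g : G} (hx : c • x = lt g x) :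
    c ^ (Fintype.card G).factorial • x = x := by
  classical
  -- the finite set of translates and the self-map `f ↦ c • f` of it
  set S : Finset (G → K) := Finset.univ.image fun h : G => lt h x with hSdef
  have hxS : x ∈ S := Finset.mem_image.2 ⟨1, Finset.mem_univ _, lt_one x⟩
  have hsmul_lt : ∀ (h : G) (f : G → K), c • lt h f = lt h (c • f) := fun h f => by
    funext y; simp only [Pi.smul_apply, lt_apply]
  have hS : ∀ f ∈ S, c • f ∈ S := by
    intro f hf
    obtain ⟨h, -, rfl⟩ := Finset.mem_image.1 hf
    rw [hsmul_lt, hx, ← lt_mul]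
    exact Finset.mem_image.2 ⟨h * g, Finset.mem_univ _, rfl⟩
  let m : S → S := fun f => ⟨c • (f : G → K), hS _ f.2⟩
  have hm_inj : Function.Injective m := fun f f' hff' => Subtype.ext
    ((hc.smul_left_cancel).1 (congrArg Subtype.val hff'))
  let σ : Equiv.Perm S := Equiv.ofBijective m (Finite.injective_iff_bijective.1 hm_inj)
  have hσpow : ∀ (j : ℕ) (f : S), ((σ ^ j) f : G → K) = c ^ j • (f : G → K) := by
    intro j
    induction j with
    | zero => intro f; rw [pow_zero, pow_zero, one_smul, Equiv.Perm.one_apply]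
    | succ j ih => intro f; rw [pow_succ, Equiv.Perm.mul_apply, ih, pow_succ, mul_smul]; rfl
  -- `σ` has order dividing `|S|! ∣ |G|!`
  have hσ1 : σ ^ (Fintype.card G).factorial = 1 := by
    have h1 : σ ^ Nat.card (Equiv.Perm S) = 1 := pow_card_eq_one'
    rw [Nat.card_eq_fintype_card, Fintype.card_perm, Fintype.card_coe] at h1
    obtain ⟨t, ht⟩ := Nat.factorial_dvd_factorial (show S.card ≤ Fintype.card G from
      (Finset.card_image_le).trans (Finset.card_univ.le))
    rw [ht, pow_mul, h1, one_pow]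
  have h := hσpow (Fintype.card G).factorial ⟨x, hxS⟩
  rw [hσ1, Equiv.Perm.one_apply] at h
  exact h.symm

/-! ### (T⇒E): the torus law forces a-balance at every level -/

/-- **(T⇒E) — Lemma 4′ of PL2-SEP-PROOF-v2 (with the refinement (R1) of the v2-NOTES), finite coefficients.**  Let a
group `Γ` act on `Ẑ` through `ρ : Γ → Aut(Ẑ)` with (Hχ‴): for every prime `ℓ` and `M ≥ 1` some `ρ(γ)^M` is
non-trivial at some `ℓ`-power level (for `ρ = χ` on `G_{ℚ_p}` this is
`SettingModel.exists_levelChar_chi_pow_ne_one`).  If `w ∈ F̂₂` satisfies the TORUS LAW for `ρ(Γ)` — `θ_{ρ(γ)}(w)` is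
conjugate to `w^{ρ(γ)(1)}` for every `γ` — then `w` is a-BALANCED AT EVERY LEVEL: for every finite group `G`, all
`A B : G` and every prime `ℓ`, `N_{π w} · α_w = 0` for the level Fox chain of `w` at `(G, ZMod ℓ, A, B)`.
Proof.  Let `n = ord B`, `q = π w`, `o = ord q`, `M₀ = φ(n)`, `E' = |G|!`; by (Hχ‴) pick `γ₀` and `k` with
`χ_{ℓ^k}(ρ(γ₀)^{M₀ E'}) ≠ 1`, and put `φ = ρ(γ₀)^{M₀}`, `u = φ(1) ≡ 1 (mod n)` (`levelChar_pow_totient`).  The torus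
law at `w^o` reads `θ_u(w^o) = g (w^o)^u g⁻¹` (`powHat_pow`), whose `a`-chains with coefficients `ℤ/ℓ^k` give
`x = π(g)·(c • x)` for `x = α_{w^o} = N_q·α_w`, `c = χ_{ℓ^k}(φ)` ((c4) `exists_fox_twistEnd_eq_torHom`,
(c1) `alpha_conj_of_lev_eq_one`, (c3) `alpha_powHat_of_lev_eq_one`); so the unit `c` permutes the translates of `x`
and `c^{E'} • x = x` (`pow_factorial_smul_eq_self`), while `c^{E'} = χ_{ℓ^k}(ρ(γ₀)^{M₀E'}) ≠ 1`; hence `x ≡ 0`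
modulo `ℓ`, i.e. `N_q·α_w = 0` with coefficients `ℤ/ℓ` (`alpha_eq_comp`). [cite: MochizukiEtTh2009, §1 p.12] -/
theorem normL_lev_alpha_eq_zero_of_torusLaw {Γ : Type*} [Group Γ] (ρ : Γ →* MulAut ZH)
    (hρ : ∀ (ℓ : ℕ) (hℓ : ℓ.Prime) (M : ℕ), M ≠ 0 →
      ∃ (γ : Γ) (k : ℕ), levelChar ⟨ℓ ^ k, pow_pos hℓ.pos k⟩ (ρ γ ^ M) ≠ 1)
    (w : F₂hatT)
    (hw : ∀ γ : Γ, ∃ g : F₂hatT, twist (ρ γ) w = g * powHat w (ρ γ (iotaZ (Multiplicative.ofAdd 1))) * g⁻¹)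
    {G : Type} [Group G] [Finite G] [DecidableEq G] (A B : G) (ℓ : ℕ) [hℓ : Fact ℓ.Prime] :
    normL (lev A B w) (alpha (k := ZMod ℓ) A B w) = 0 := by
  classical
  cases nonempty_fintype G
  -- Step 0: the level data
  set q : G := lev A B w with hq
  set o : ℕ := orderOf q with ho
  have hqo : q ^ o = 1 := pow_orderOf_eq_one q
  have hlevwo : lev A B (w ^ o) = 1 := by rw [map_pow, ← hq, hqo]
  set n : ℕ := orderOf B with hn
  have hn0 : 0 < n := orderOf_pos B
  have hBn : B ^ n = 1 := pow_orderOf_eq_one B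
  -- Step 1: exponents and the (Hχ‴) witness
  set M₀ : ℕ := Nat.totient n with hM₀
  set E' : ℕ := (Fintype.card G).factorial with hE'
  have hM : M₀ * E' ≠ 0 := mul_ne_zero (Nat.totient_pos.2 hn0).ne' (Nat.factorial_ne_zero _)
  obtain ⟨σ₀, k, hne⟩ := hρ ℓ hℓ.out _ hM
  have hk : k ≠ 0 := by
    rintro rfl
    apply hne
    have hsub : Subsingleton (ZMod (((⟨ℓ ^ 0, pow_pos hℓ.out.pos 0⟩ : ℕ+) : ℕ))) :=
      (ZMod.subsingleton_iff).2 (pow_zero ℓ)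
    exact @Subsingleton.elim _ hsub _ _
  haveI : NeZero (ℓ ^ k) := ⟨pow_ne_zero k hℓ.out.ne_zero⟩
  -- Step 2: `φ = ρ(γ₀)^{M₀}`, `u = φ(1) ≡ 1 (mod n)`
  set φ : MulAut ZH := ρ σ₀ ^ M₀ with hφ
  set u : ZH := φ (iotaZ (Multiplicative.ofAdd 1)) with hu
  have hun : Multiplicative.toAdd (level ⟨n, hn0⟩ u) = 1 := by
    change levelChar ⟨n, hn0⟩ φ = 1
    rw [hφ, map_pow]
    exact levelChar_pow_totient ⟨n, hn0⟩ (ρ σ₀)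
  -- Step 3: the torus law at `w` and at `w^o`
  obtain ⟨g, hg⟩ := hw (σ₀ ^ M₀)
  rw [map_pow, ← hφ, ← hu] at hg
  have hgo : twist φ (w ^ o) = g * powHat (w ^ o) u * g⁻¹ := by
    rw [map_pow, hg, conj_pow, ← powHat_pow]
  -- Step 4: `a`-chains with coefficients `ℤ/ℓ^k`
  haveI : Finite (W G (ZMod (ℓ ^ k))) := DehnTwist.finite_W
  obtain ⟨E₀, hE₀⟩ : ∃ E₀ : ℕ+, ∀ z : W G (ZMod (ℓ ^ k)), z ^ (E₀ : ℕ) = 1 :=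
    ⟨⟨Monoid.exponent (W G (ZMod (ℓ ^ k))), Monoid.ExponentExists.of_finite.exponent_pos⟩,
      fun z => Monoid.pow_exponent_eq_one z⟩
  set E : ℕ+ := E₀ * ⟨ℓ ^ k, pow_pos hℓ.out.pos k⟩ with hEdef
  have hE : ∀ z : W G (ZMod (ℓ ^ k)), z ^ (E : ℕ) = 1 := fun z => by
    rw [hEdef, PNat.mul_coe, pow_mul, hE₀, one_pow]
  have hlevpow : lev A B (powHat (w ^ o) u) = 1 := by
    rw [lev_powHat A B ⟨Fintype.card G, Fintype.card_pos⟩ (fun g => pow_card_eq_one) (w ^ o) u, hlevwo, one_pow]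
  set x : G → ZMod (ℓ ^ k) := alpha (k := ZMod (ℓ ^ k)) A B (w ^ o) with hxdef
  -- LHS: the twist does not change the `a`-chain
  obtain ⟨qq, hfox⟩ := exists_fox_twistEnd_eq_torHom (k := ZMod (ℓ ^ k)) A B hn0 hBn hun
  have hL : alpha (k := ZMod (ℓ ^ k)) A B (twist φ (w ^ o)) = x := by
    rw [twist_apply, ← hu, alpha_def, hfox, fst_left_torHom, ← alpha_def]
  -- RHS: conjugating the `u`-th power of the `Ker π`-element `w^o`
  have hR : alpha (k := ZMod (ℓ ^ k)) A B (g * powHat (w ^ o) u * g⁻¹) =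
      lt (lev A B g) ((Multiplicative.toAdd (level E u)).val • x) := by
    rw [alpha_conj_of_lev_eq_one A B g hlevpow, alpha_powHat_of_lev_eq_one A B E hE hlevwo u]
  -- the scalar `c = χ_{ℓ^k}(φ)`
  set c : ZMod (ℓ ^ k) := levelChar ⟨ℓ ^ k, pow_pos hℓ.out.pos k⟩ φ with hcdef
  have hcE : ((Multiplicative.toAdd (level E u)).val : ZMod (ℓ ^ k)) = c := by
    haveI : NeZero ((E : ℕ+) : ℕ) := ⟨E.ne_zero⟩
    have hdvd : ((⟨ℓ ^ k, pow_pos hℓ.out.pos k⟩ : ℕ+) : ℕ) ∣ (E : ℕ) := ⟨E₀, by rw [hEdef, mul_comm]; rfl⟩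
    have hcomp := (LevelFamily.ofZHat u).compat ⟨ℓ ^ k, pow_pos hℓ.out.pos k⟩ E hdvd
    rw [LevelFamily.ofZHat_c, LevelFamily.ofZHat_c, ZMod.castHom_apply, ZMod.cast_eq_val] at hcomp
    exact hcomp.trans (by rw [hcdef, levelChar_apply]; rfl)
  have hsmul : (Multiplicative.toAdd (level E u)).val • x = c • x := by
    funext y
    rw [Pi.smul_apply, Pi.smul_apply, nsmul_eq_mul, hcE, smul_eq_mul]
  have hxeq : c • x = lt (lev A B g)⁻¹ x := by
    have h1 : x = lt (lev A B g) (c • x) := by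
      calc x = alpha (k := ZMod (ℓ ^ k)) A B (twist φ (w ^ o)) := hL.symm
        _ = lt (lev A B g) (c • x) := by rw [hgo, hR, hsmul]
    calc c • x = lt (lev A B g)⁻¹ (lt (lev A B g) (c • x)) := by rw [← lt_mul, inv_mul_cancel, lt_one]
      _ = lt (lev A B g)⁻¹ x := by rw [← h1]
  -- Step 5: `c` is a unit permuting the translates of `x`, so `c^{E'} • x = x`
  have hcunit : IsUnit c := isUnit_iff_exists_inv.2 ⟨_, levelChar_mul_levelChar_inv _ φ⟩
  have hfix : c ^ E' • x = x := pow_factorial_smul_eq_self hcunit hxeq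
  -- Step 6: but `c^{E'} = χ_{ℓ^k}(ρ(γ₀)^{M₀ E'}) ≠ 1`
  have hcE' : c ^ E' ≠ 1 := by
    intro h
    apply hne
    rw [pow_mul, ← hφ, map_pow, ← hcdef]
    exact h
  have hzero : (c ^ E' - 1) • x = 0 := by rw [sub_smul, one_smul, hfix, sub_self]
  -- Step 7: reduce modulo `ℓ`
  rw [← alpha_pow_orderOf_lev, ← ho,
    alpha_eq_comp A B (ZMod.castHom (dvd_pow_self ℓ hk) (ZMod ℓ)) (w ^ o), ← hxdef]
  funext y
  rw [Function.comp_apply, Pi.zero_apply]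
  exact cast_eq_zero_of_mul_eq_zero hℓ.out hk (sub_ne_zero.2 hcE')
    (by have := congrFun hzero y; rwa [Pi.smul_apply, smul_eq_mul, Pi.zero_apply] at this)

end Literature.AnabelianGeometry.EtaleTheta.SettingModel

end
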